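import Summits.Parity.BatemanHorn.Theorems.RoughValueTransportBalancedSemiprimeLayerQuadraticSieveRemainder
import HarnessLib

/-!
# Quadratic sieve for the balanced-semiprime layer, 4/7: the sieve bound at one height

The line `smooth-modulus-twisted-hooley` of crux `BalancedSemiprimeLayer` (route
`RoughValueTransport`, item stmt-Parity-9469) bounds the relaxed sifted divisor family
`pairFamily f i δ c x` of a QUADRATIC coordinate `g = fᵢ = aX² + bX + c` of a Bateman–Horn system
`f` (window `m ∈ (x^{1−δ}, x^{1+δ}]`, `m ∣ g(n)`, `(m, B) = 1`, `B = |2a·disc g|`, every `fⱼ(n)`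
free of primes `< x^c`) by ONE `(k+1)`-dimensional upper-bound sieve: the pairs `(n, m)` are
booked at the value `F(n) = ∏ⱼ fⱼ(n)` and sifted by the primes `< z = x^c` (the tree's PROVED
Fundamental Lemma `SieveSequence.fundamental_lemma_explicit`); the main term comes from the window
sums of `ρ_g(m)/m` (the tree's PROVED `RhoLogSums.abs_rhoLogSum_sub_le`), the remainders ARE the
uniform Type-I information `UniformTypeI g` on dyadic blocks of `n`.  The proof is spread over
seven files `RoughValueTransportBalancedSemiprimeLayerQuadraticSieve<Part>.lean`, `<Part>` =
`Defs`, `Sequence`, `Remainder`, `Core`, `Bookkeeping`, `Height`, and the empty suffix (the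
registered stub `stub_quadraticSieve`).

This file: `core_bound` — the Fundamental Lemma (`SieveSequence.fundamental_lemma_explicit`,
level `D = z`) applied to the pair sequence, with the remainder sum bounded crudely by
`z²(J z E_T + yTot·z·(2𝔠/U + 4 K_V z³/√U))` — and the inputs of the assembly: `ω_{fᵢ} ≤ ω_f`,
`![fᵢ]` is a Bateman–Horn system, the sieve product of `G` in terms of the Bateman–Horn partial
products (`prod_one_sub_pairDensity_le`), the Type-I hypothesis on the blocks from the unpacked
`UniformTypeI` (`typeI_blocks`), and the splitting of `#pairFamily` at `n = Y`
(`card_pairFamily_le_add`, `card_pairFamily_filter_le`).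
-/

noncomputable section

open Polynomial Filter Finset
open Literature.NumberTheory.Sieve
open scoped ArithmeticFunction.Moebius NumberTheorySymbols

namespace Summit.Parity.BatemanHorn.Cruxes.BalancedSemiprimeLayer.SmoothModulusTwistedHooley

namespace QuadraticSieve

open Iwaniec1978 RhoLogSums PropertySTypeI

variable {a b c : ℤ}

/-! ### H. The sieve bound at one height (all parameters explicit) -/

section Core

variable {χ : DirichletCharacter ℂ (4 * (b ^ 2 - 4 * a * c).natAbs)}

/-- **The upper-bound sieve for the pair family at one height.**  Let `G = aX² + bX + c ∣ F`,
let `G_F = pairDensity a b c F` have sieve dimension `κ > 0` with constant `K`, let `1 ≤ U ≤ V`,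
`F > 0` on `(Y, 2^J Y]`, `2 ≤ z`, and assume the Type-I bound `HT` for every block, every modulus
`q ≤ z` and level `ℓ ≤ z` with error `E_T ≥ 0`.  Then
`∑_{U<m≤V, (m,B)=1} #{Y < n ≤ 2^J Y : m ∣ G(n), (F(n), P(z)) = 1}
   ≤ (1 + C(κ,K))·𝔠·log(V/U)·yTot·∏_{p<z}(1 − G_F(p)) + z²·(J z E_T + yTot·z·(2𝔠/U + 4 K_V z³/√U))`
(the tree's PROVED Fundamental Lemma `SieveSequence.fundamental_lemma_explicit` at level `D = z`,
and `abs_remainder_pairSeq_le` with `τ(d) ≤ d ≤ z`, `#{d ∣ P(z) : d ≤ z} ≤ z`).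
[cite: FriedlanderIwaniecOpera2010, Cor. 6.10 (the fundamental lemma used, via the tree)] -/
theorem core_bound (ha : 0 < a) (hirr : Irreducible (quadPoly a b c))
    (hχ : ∀ n : ℕ, Odd n → χ n = (J(b ^ 2 - 4 * a * c | n) : ℂ))
    [NeZero (4 * (b ^ 2 - 4 * a * c).natAbs)]
    {F : ℤ[X]} (hGF : quadPoly a b c ∣ F)
    {κ K : ℝ} (hκ : 0 < κ) (hdim : HasSieveDimension (pairDensity a b c F) κ K)
    {U V Y J : ℕ} (hU : 1 ≤ U) (hUV : U ≤ V)
    (hFpos : ∀ n ∈ Ioc Y (2 ^ J * Y), 0 < F.eval (n : ℤ))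
    {z ET : ℝ} (hz : 2 ≤ z) (hET : 0 ≤ ET)
    (HT : ∀ j ∈ range J, ∀ q r : ℕ, 1 ≤ q → (q : ℝ) ≤ z → ∀ ℓ : ℕ, 1 ≤ ℓ → (ℓ : ℝ) ≤ z →
      |∑ m ∈ modSet U V ℓ q (badB a b c),
          ((blockCount (quadPoly a b c) Y j q r m : ℝ) -
            ((2 ^ j * Y : ℕ) : ℝ) / q * (rhoG a b c m : ℝ) / m)| ≤ ET) :
    ∑ m ∈ (Ioc U V).filter (fun m : ℕ => m.Coprime (badB a b c)),
        (#((Ioc Y (2 ^ J * Y)).filter fun n : ℕ => (m : ℤ) ∣ (quadPoly a b c).eval (n : ℤ) ∧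
          (F.eval (n : ℤ)).natAbs.Coprime (primesProdBelow z)) : ℝ) ≤
      (1 + SieveSequence.flConst κ K) *
          (cMain χ (badQ a b c) * Real.log ((V : ℝ) / U) * yTot Y J) *
          ∏ p ∈ Nat.primesBelow ⌈z⌉₊, (1 - pairDensity a b c F p) +
        z ^ 2 * ((J : ℝ) * z * ET + yTot Y J * z *
          (2 * cMain χ (badQ a b c) / U + 4 * (kWin χ (badQ a b c) V * z ^ 3) / Real.sqrt U)) := by
  set G := quadPoly a b c with hGdef
  set B := badB a b c with hBdef
  set Q₀ := badQ a b c with hQ₀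
  set 𝔠 := cMain χ Q₀ with h𝔠def
  set L := Real.log ((V : ℝ) / U) with hL
  set R := Ioc Y (2 ^ J * Y) with hR
  set Xs : ℝ := 𝔠 * L * yTot Y J with hXs
  set 𝒜 := pairSeq G F R ((Ioc U V).filter (fun m : ℕ => m.Coprime B)) Xs (pairDensity a b c F)
    (isMultiplicative_pairDensity a b c F) with h𝒜
  -- the height `x'` bounding the values on `R`
  set x' : ℝ := ∑ n ∈ R, ((F.eval (n : ℤ) : ℤ) : ℝ) with hx'
  have hx : ∀ n ∈ R, 0 < F.eval (n : ℤ) ∧ ((F.eval (n : ℤ) : ℤ) : ℝ) ≤ x' := fun n hn =>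
    ⟨hFpos n hn, Finset.single_le_sum (f := fun n : ℕ => ((F.eval (n : ℤ) : ℤ) : ℝ))
      (fun m hm => by exact_mod_cast (hFpos m hm).le) hn⟩
  -- positivity of the size
  have h𝔠 : 0 < 𝔠 := const_pos ha hirr hχ (squarefree_badQ a b c)
  have hU0 : (0 : ℝ) < U := by exact_mod_cast hU
  have hL0 : 0 ≤ L := Real.log_nonneg (by rw [le_div_iff₀ hU0, one_mul]; exact_mod_cast hUV)
  have hYt : 0 ≤ yTot Y J := yTot_nonneg Y J
  have hXs0 : 0 ≤ Xs := by positivity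
  have hK0 : 0 ≤ kWin χ Q₀ V := kWin_nonneg χ Q₀ (hU.trans hUV)
  have hz0 : 0 ≤ z := by linarith
  -- the Fundamental Lemma
  have hdim' : HasSieveDimension 𝒜.density κ K := hdim
  have hFL := SieveSequence.fundamental_lemma_explicit hdim' hκ hz le_rfl
    (show 0 ≤ 𝒜.size x' from hXs0)
  have hsize : 𝒜.size x' = Xs := rfl
  have hV : 𝒜.densityProduct (primesProdBelow z) = ∏ p ∈ Nat.primesBelow ⌈z⌉₊, (1 - pairDensity a b c F p) := by
    rw [SieveSequence.densityProduct, primeFactors_primesProdBelow]; rfl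
  have hsift : 𝒜.sifted x' (primesProdBelow z) =
      ∑ m ∈ (Ioc U V).filter (fun m : ℕ => m.Coprime B),
        (#(R.filter fun n : ℕ => (m : ℤ) ∣ G.eval (n : ℤ) ∧
          (F.eval (n : ℤ)).natAbs.Coprime (primesProdBelow z)) : ℝ) :=
    sifted_pairSeq G F R _ Xs _ _ hx (primesProdBelow z)
  rw [hsize, hV, hsift] at hFL
  set VG := ∏ p ∈ Nat.primesBelow ⌈z⌉₊, (1 - pairDensity a b c F p) with hVG
  have hVG0 : 0 < VG := Finset.prod_pos fun p hp =>
    sub_pos.mpr (hdim.1 p (Nat.prime_of_mem_primesBelow hp)).2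
  -- the remainder sum
  set W := (primesProdBelow z).divisors.filter (fun d : ℕ => (d : ℝ) ≤ z) with hW
  set Rem : ℝ := (J : ℝ) * z * ET + yTot Y J * z *
    (2 * 𝔠 / U + 4 * (kWin χ Q₀ V * z ^ 3) / Real.sqrt U) with hRem
  have hRem0 : 0 ≤ Rem := by positivity
  have hRd : ∀ d ∈ W, |𝒜.remainder d x'| ≤ z * Rem := by
    intro d hd
    rw [hW, Finset.mem_filter] at hd
    have hdsq : Squarefree d :=
      (squarefree_primesProdBelow z).squarefree_of_dvd (Nat.dvd_of_mem_divisors hd.1)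
    have h := abs_remainder_pairSeq_le ha hirr hχ hGF hU hUV hx hET HT hdsq hd.2 (χ := χ)
    refine h.trans ?_
    have hτ : (#d.divisors : ℝ) ≤ z := le_trans (by exact_mod_cast Nat.card_divisors_le_self d) hd.2
    have hτ0 : (0 : ℝ) ≤ #d.divisors := Nat.cast_nonneg _
    rw [hRem]
    have h1 : (J : ℝ) * d * ET ≤ (J : ℝ) * z * ET := by gcongr; exact hd.2
    have h2 : yTot Y J * #d.divisors *
        (2 * 𝔠 / U + 4 * (kWin χ Q₀ V * (#d.divisors : ℝ) ^ 3) / Real.sqrt U) ≤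
        yTot Y J * z * (2 * 𝔠 / U + 4 * (kWin χ Q₀ V * z ^ 3) / Real.sqrt U) := by gcongr
    exact mul_le_mul hτ (add_le_add h1 h2) (by positivity) hz0
  have hWsub : W ⊆ Icc 1 ⌊z⌋₊ := by
    intro d hd
    rw [hW, Finset.mem_filter, Nat.mem_divisors] at hd
    rw [Finset.mem_Icc]
    exact ⟨Nat.pos_of_dvd_of_pos hd.1.1 (Nat.pos_of_ne_zero hd.1.2), Nat.le_floor hd.2⟩
  have hWcard : (#W : ℝ) ≤ z := by
    have h1 : #W ≤ ⌊z⌋₊ := (Finset.card_le_card hWsub).trans (by simp)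
    calc (#W : ℝ) ≤ ⌊z⌋₊ := by exact_mod_cast h1
      _ ≤ z := Nat.floor_le hz0
  have hRsum : ∑ d ∈ W, |𝒜.remainder d x'| ≤ z ^ 2 * Rem := by
    calc ∑ d ∈ W, |𝒜.remainder d x'| ≤ ∑ _d ∈ W, z * Rem := Finset.sum_le_sum hRd
      _ = #W * (z * Rem) := by rw [Finset.sum_const, nsmul_eq_mul]
      _ ≤ z * (z * Rem) := mul_le_mul_of_nonneg_right hWcard (by positivity)
      _ = z ^ 2 * Rem := by ring
  -- assemble
  have hexp : Real.exp (-(Real.log z / Real.log z)) ≤ 1 := by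
    rw [Real.exp_le_one_iff, neg_nonpos]
    exact div_nonneg (Real.log_nonneg (by linarith)) (Real.log_nonneg (by linarith))
  have hfl0 : 0 ≤ SieveSequence.flConst κ K :=
    (SieveSequence.flConst_pos hκ.le (lt_of_lt_of_le one_pos hdim.one_le)).le
  have hmain : SieveSequence.flConst κ K * Xs * VG * Real.exp (-(Real.log z / Real.log z)) ≤
      SieveSequence.flConst κ K * Xs * VG :=
    mul_le_of_le_one_right (by positivity) hexp
  have hab := (abs_le.mp hFL).2
  change ∑ m ∈ (Ioc U V).filter (fun m : ℕ => m.Coprime B),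
      (#(R.filter fun n : ℕ => (m : ℤ) ∣ G.eval (n : ℤ) ∧
        (F.eval (n : ℤ)).natAbs.Coprime (primesProdBelow z)) : ℝ) ≤
    (1 + SieveSequence.flConst κ K) * Xs * VG + z ^ 2 * Rem
  nlinarith [hab, hRsum, hmain]

end Core

/-! ### I. Inputs of the assembly: the system `f`, the coordinate `g = fᵢ`, the blocks -/

/-- `ω_{fᵢ}(p) ≤ ω_f(p)`: a root of one member is a root of the product. [folklore] -/
theorem polyRootCountMod_single_le {k : ℕ} (f : Fin k → ℤ[X]) (i : Fin k) (p : ℕ) :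
    polyRootCountMod ![f i] p ≤ polyRootCountMod f p := by
  unfold polyRootCountMod
  refine Finset.card_le_card fun n hn => ?_
  rw [Finset.mem_filter] at hn ⊢
  refine ⟨hn.1, ?_⟩
  have h : (∏ j : Fin 1, (![f i] j).eval (n : ℤ)) = (f i).eval (n : ℤ) := by simp
  rw [h] at hn
  exact hn.2.trans (Finset.dvd_prod_of_mem (fun j => (f j).eval (n : ℤ)) (Finset.mem_univ i))

/-- A single member of a Bateman–Horn system is a Bateman–Horn system. [folklore] -/
theorem isBatemanHornSystem_single {k : ℕ} {f : Fin k → ℤ[X]} (hf : IsBatemanHornSystem f)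
    (i : Fin k) : IsBatemanHornSystem ![f i] where
  irreducible j := by
    have : ![f i] j = f i := by simp
    rw [this]; exact hf.irreducible i
  leadingCoeff_pos j := by
    have : ![f i] j = f i := by simp
    rw [this]; exact hf.leadingCoeff_pos i
  pairwise_not_associated := Subsingleton.pairwise
  hasNoFixedPrimeDivisor p hp :=
    lt_of_le_of_lt (polyRootCountMod_single_le f i p) (hf.hasNoFixedPrimeDivisor p hp)

/-- **The sieve product of the pair density**, in terms of the Bateman–Horn partial products:
`∏_{p ≤ y}(1 − G(p)) ≤ Q₀ e⁶ · Π_{![g]}(y) · Π_f(y) · (∏_{p ≤ y}(1 − 1/p))^{k+1}`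
(`1 − G(p) = (1 − g(p))(1 − ω_f(p)/p)`, `prod_one_sub_rhoDensity_le`,
`PolyPrimeCountBrun.prod_one_sub_rootCount_eq` for `![fᵢ]` and for `f`). [folklore] -/
theorem prod_one_sub_pairDensity_le (ha : 0 < a) (hirr : Irreducible (quadPoly a b c))
    {k : ℕ} {f : Fin k → ℤ[X]} (i : Fin k) (hg : f i = quadPoly a b c)
    (hρ : ∀ p : ℕ, p.Prime → polyRootCountMod f p < p) (y : ℕ) :
    ∏ p ∈ Nat.primesLE y, (1 - pairDensity a b c (∏ j, f j) p) ≤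
      (badQ a b c : ℝ) * Real.exp 6 * batemanHornPartial ![f i] y * batemanHornPartial f y *
        (∏ p ∈ Nat.primesLE y, (1 - 1 / (p : ℝ))) ^ (k + 1) := by
  have hB : badB a b c ≠ 0 := badB_ne_zero ha hirr
  set F : ℤ[X] := ∏ j, f j with hF
  set M : ℝ := ∏ p ∈ Nat.primesLE y, (1 - 1 / (p : ℝ)) with hM
  have hprime : ∀ p ∈ Nat.primesLE y, p.Prime := fun p hp => Nat.prime_of_mem_primesLE hp
  have hρF : ∀ p, polyRootCountMod ![F] p = polyRootCountMod f p := fun p =>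
    (PolyPrimeCountBrun.polyRootCountMod_eq_single_prod f p).symm
  have hρg : ∀ p, rhoG a b c p = polyRootCountMod ![f i] p := fun p => by rw [hg]; rfl
  have hρglt : ∀ p : ℕ, p.Prime → rhoG a b c p < p := fun p hp => by
    rw [hρg]; exact lt_of_le_of_lt (polyRootCountMod_single_le f i p) (hρ p hp)
  rw [Finset.prod_congr rfl fun p hp => one_sub_pairDensity_prime F (hprime p hp),
    Finset.prod_mul_distrib]
  have h1 := prod_one_sub_rhoDensity_le ha hB hρglt y
  have h1' : ∏ p ∈ Nat.primesLE y, (1 - (rhoG a b c p : ℝ) / p) = batemanHornPartial ![f i] y * M := by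
    have h := PolyPrimeCountBrun.prod_one_sub_rootCount_eq ![f i] y
    rw [pow_one] at h
    rw [← h]
    exact Finset.prod_congr rfl fun p _ => by rw [hρg]
  have h2 : ∏ p ∈ Nat.primesLE y, (1 - (polyRootCountMod ![F] p : ℝ) / p) =
      batemanHornPartial f y * M ^ k := by
    rw [← PolyPrimeCountBrun.prod_one_sub_rootCount_eq f y]
    exact Finset.prod_congr rfl fun p _ => by rw [hρF]
  have h2nn : 0 ≤ ∏ p ∈ Nat.primesLE y, (1 - (polyRootCountMod ![F] p : ℝ) / p) :=
    Finset.prod_nonneg fun p hp => by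
      have hp0 : (0 : ℝ) < p := by exact_mod_cast (hprime p hp).pos
      rw [sub_nonneg, div_le_one hp0]
      exact_mod_cast polyRootCountMod_le ![F] p
  calc (∏ p ∈ Nat.primesLE y, (1 - rhoDensity a b c (badQ a b c) p)) *
        ∏ p ∈ Nat.primesLE y, (1 - (polyRootCountMod ![F] p : ℝ) / p)
      ≤ ((badQ a b c : ℝ) * Real.exp 6 * (batemanHornPartial ![f i] y * M)) *
          (batemanHornPartial f y * M ^ k) := by
        rw [← h1', ← h2]
        exact mul_le_mul_of_nonneg_right h1 h2nn
    _ = (badQ a b c : ℝ) * Real.exp 6 * batemanHornPartial ![f i] y * batemanHornPartial f y *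
          M ^ (k + 1) := by ring

/-- **The Type-I hypothesis on the blocks.**  From the (unpacked) uniform Type-I information for
`G` with exponents `θ, ε₀` and constant `K_T` beyond `y₀`: if `y₀ ≤ Y`, `1 ≤ Y`, all blocks lie
below `x` (`2^j Y ≤ x` for `j < J`), `z ≤ Y^θ`, `U ≤ V ≤ Y^{1+θ}` and `ε₁ ≤ min(ε₀, 1)`, then
every block satisfies the Type-I bound with error `max(K_T, 0)·x^{1−ε₁}` for all moduli `q ≤ z` and
levels `ℓ ≤ z`. [folklore] -/
theorem typeI_blocks {θ ε₀ KT : ℝ} (hθ : 0 ≤ θ) {y₀ : ℕ}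
    (hT : ∀ y : ℕ, y₀ ≤ y → ∀ q b₀ : ℕ, 1 ≤ q → (q : ℝ) ≤ (y : ℝ) ^ θ →
      ∀ ℓ N₁ N₂ : ℕ, 1 ≤ ℓ → (ℓ : ℝ) ≤ (y : ℝ) ^ θ → N₁ ≤ N₂ → (N₂ : ℝ) ≤ (y : ℝ) ^ (1 + θ) →
      |∑ n ∈ (Ioc N₁ N₂).filter (fun n : ℕ => ℓ ∣ n ∧ n.Coprime (q * badB a b c)),
        ((#((Ioc y (2 * y)).filter (fun t : ℕ => t % q = b₀ % q ∧
            (n : ℤ) ∣ (quadPoly a b c).eval (t : ℤ))) : ℝ) -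
          (y : ℝ) / q * (polyRootCountMod ![quadPoly a b c] n : ℝ) / n)| ≤
        KT * (y : ℝ) ^ (1 - ε₀))
    {U V Y J : ℕ} {z xr ε₁ : ℝ} (hY₀ : y₀ ≤ Y) (hY1 : 1 ≤ Y)
    (hblocks : ∀ j ∈ range J, ((2 ^ j * Y : ℕ) : ℝ) ≤ xr) (hzY : z ≤ (Y : ℝ) ^ θ)
    (hUV : U ≤ V) (hVY : (V : ℝ) ≤ (Y : ℝ) ^ (1 + θ)) (hε₁ε₀ : ε₁ ≤ ε₀) (hε₁1 : ε₁ ≤ 1) :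
    ∀ j ∈ range J, ∀ q r : ℕ, 1 ≤ q → (q : ℝ) ≤ z → ∀ ℓ : ℕ, 1 ≤ ℓ → (ℓ : ℝ) ≤ z →
      |∑ m ∈ modSet U V ℓ q (badB a b c),
          ((blockCount (quadPoly a b c) Y j q r m : ℝ) -
            ((2 ^ j * Y : ℕ) : ℝ) / q * (rhoG a b c m : ℝ) / m)| ≤ max KT 0 * xr ^ (1 - ε₁) := by
  intro j hj q r hq hqz ℓ hℓ hℓz
  set y : ℕ := 2 ^ j * Y with hy
  have hYy : Y ≤ y := Nat.le_mul_of_pos_left Y (by positivity)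
  have hy₀ : y₀ ≤ y := hY₀.trans hYy
  have hY1r : (1 : ℝ) ≤ Y := by exact_mod_cast hY1
  have hYyr : (Y : ℝ) ≤ y := by exact_mod_cast hYy
  have hy1 : (1 : ℝ) ≤ y := hY1r.trans hYyr
  have hθy : (Y : ℝ) ^ θ ≤ (y : ℝ) ^ θ := Real.rpow_le_rpow (by positivity) hYyr hθ
  have hθy' : (Y : ℝ) ^ (1 + θ) ≤ (y : ℝ) ^ (1 + θ) :=
    Real.rpow_le_rpow (by positivity) hYyr (by linarith)
  have h := hT y hy₀ q r hq (hqz.trans (hzY.trans hθy)) ℓ U V hℓ (hℓz.trans (hzY.trans hθy)) hUV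
    (hVY.trans hθy')
  refine h.trans ?_
  have hxr : (y : ℝ) ≤ xr := hblocks j hj
  calc KT * (y : ℝ) ^ (1 - ε₀) ≤ max KT 0 * (y : ℝ) ^ (1 - ε₀) :=
        mul_le_mul_of_nonneg_right (le_max_left _ _) (by positivity)
    _ ≤ max KT 0 * (y : ℝ) ^ (1 - ε₁) :=
        mul_le_mul_of_nonneg_left (Real.rpow_le_rpow_of_exponent_le hy1 (by linarith))
          (le_max_right _ _)
    _ ≤ max KT 0 * xr ^ (1 - ε₁) :=
        mul_le_mul_of_nonneg_left (Real.rpow_le_rpow (by positivity) hxr (by linarith))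
          (le_max_right _ _)

/-- **`#pairFamily` splits at `n = Y`**, and the pairs with `n > Y` are among the sifted pairs
counted by `core_bound` (window `(U, V] = quadWindow`, blocks `(Y, 2^J Y] ⊇ (Y, x]`, `m ∣ G(n)`,
`(m, B) = 1`, and `F(n) = ∏ⱼ fⱼ(n)` free of primes `< x^c`). [folklore] -/
theorem card_pairFamily_le_add {k : ℕ} (f : Fin k → ℤ[X]) (i : Fin k) {G : ℤ[X]} (hG : f i = G)
    {Bn : ℕ} (hBn : (2 * (f i).coeff 2 *
      discrim ((f i).coeff 2) ((f i).coeff 1) ((f i).coeff 0)).natAbs = Bn)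
    (δ cc : ℝ) (x : ℕ) {U V Y J : ℕ} (hUw : ⌈(x : ℝ) ^ (1 - δ)⌉₊ = U + 1)
    (hVw : ⌊(x : ℝ) ^ (1 + δ)⌋₊ = V) (hxY : x ≤ 2 ^ J * Y) :
    #(pairFamily f i δ cc x) ≤ #((pairFamily f i δ cc x).filter (fun nm : ℕ × ℕ => nm.1 ≤ Y)) +
      ∑ m ∈ (Ioc U V).filter (fun m : ℕ => m.Coprime Bn),
        #((Ioc Y (2 ^ J * Y)).filter fun n : ℕ => (m : ℤ) ∣ G.eval (n : ℤ) ∧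
          ((∏ j, f j).eval (n : ℤ)).natAbs.Coprime (primesProdBelow ((x : ℝ) ^ cc))) := by
  set R := Ioc Y (2 ^ J * Y) with hR
  set M := (Ioc U V).filter (fun m : ℕ => m.Coprime Bn) with hM
  set P : ℕ → ℕ → Prop := fun m n => (m : ℤ) ∣ G.eval (n : ℤ) ∧
    ((∏ j, f j).eval (n : ℤ)).natAbs.Coprime (primesProdBelow ((x : ℝ) ^ cc)) with hP
  -- the sum over `m` is the cardinality of a set of pairs
  have hsum : ∑ m ∈ M, #(R.filter fun n : ℕ => P m n) =
      #((R ×ˢ M).filter fun nm : ℕ × ℕ => P nm.2 nm.1) := by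
    rw [Finset.card_filter, Finset.sum_product_right]
    refine Finset.sum_congr rfl fun m _ => ?_
    rw [Finset.card_filter]
  rw [← Finset.card_filter_add_card_filter_not (fun nm : ℕ × ℕ => nm.1 ≤ Y)]
  change _ ≤ _ + ∑ m ∈ M, #(R.filter fun n : ℕ => P m n)
  rw [hsum]
  refine Nat.add_le_add_left (Finset.card_le_card fun nm hnm => ?_) _
  rw [Finset.mem_filter, mem_pairFamily] at hnm
  obtain ⟨⟨⟨hn, hm⟩, hrough, hdvd, hcop⟩, hnY⟩ := hnm
  rw [Finset.mem_Icc] at hn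
  rw [Finset.mem_filter, Finset.mem_product]
  refine ⟨⟨?_, ?_⟩, ?_, ?_⟩
  · rw [hR, Finset.mem_Ioc]; omega
  · rw [hM, Finset.mem_filter, Finset.mem_Ioc]
    unfold quadWindow at hm
    rw [Finset.mem_Icc, hUw, hVw] at hm
    rw [← hBn]
    exact ⟨⟨by omega, hm.2⟩, hcop⟩
  · rw [← hG]; exact hdvd
  · rw [coprime_primesProdBelow_iff]
    intro q hq hqF
    rw [Nat.mem_primesBelow] at hq
    have hqZ : (q : ℤ) ∣ (∏ j, f j).eval (nm.1 : ℤ) := Int.natCast_dvd.mpr hqF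
    rw [Polynomial.eval_prod] at hqZ
    obtain ⟨j, -, hj⟩ := (Prime.dvd_finsetProd_iff (Nat.prime_iff_prime_int.mp hq.2) _).mp hqZ
    exact (hrough j).2 q (Finset.mem_range.mpr hq.1) hq.2 hj

/-- **The pairs with `n ≤ Y` are few**: `m` is a divisor of `g(n)` prime to `P(x^c)` and
`0 < g(n) ≤ K_g Y² < ⌈x^c⌉^{J'+1}`, so there are at most `2^{J'}` of them per `n`
(`PropertySTypeI.card_rough_divisors_le`). [folklore] -/
theorem card_pairFamily_filter_le {k : ℕ} (f : Fin k → ℤ[X]) (i : Fin k) (ha : 0 < a)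
    (hg : f i = quadPoly a b c) (δ cc : ℝ) (x : ℕ) {Y J' : ℕ} (hY1 : 1 ≤ Y)
    (hbound : (sizeK a b c : ℝ) * (Y : ℝ) ^ 2 < ((⌈(x : ℝ) ^ cc⌉₊ ^ (J' + 1) : ℕ) : ℝ)) :
    #((pairFamily f i δ cc x).filter (fun nm : ℕ × ℕ => nm.1 ≤ Y)) ≤ Y * 2 ^ J' := by
  set S := (pairFamily f i δ cc x).filter (fun nm : ℕ × ℕ => nm.1 ≤ Y) with hS
  set Pz := primesProdBelow ((x : ℝ) ^ cc) with hPz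
  have hPzdvd : ∀ p : ℕ, p.Prime → p < ⌈(x : ℝ) ^ cc⌉₊ → p ∣ Pz := fun p hp hlt =>
    (dvd_primesProdBelow_iff hp _).mpr (Nat.lt_ceil.mp hlt)
  have hmaps : ∀ nm ∈ S, nm.1 ∈ Icc 1 Y := by
    intro nm hnm
    rw [hS, Finset.mem_filter, mem_pairFamily] at hnm
    rw [Finset.mem_Icc]
    exact ⟨(Finset.mem_Icc.mp hnm.1.1.1).1, hnm.2⟩
  rw [Finset.card_eq_sum_card_fiberwise hmaps]
  have hfib : ∀ n ∈ Icc 1 Y, #(S.filter fun nm : ℕ × ℕ => nm.1 = n) ≤ 2 ^ J' := by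
    intro n hn
    rw [Finset.mem_Icc] at hn
    have hY1r : (1 : ℝ) ≤ Y := by exact_mod_cast hY1
    have hnY : (n : ℝ) ≤ Y := by exact_mod_cast hn.2
    -- the value `g(n)` and its size
    have hval : ((quadPoly a b c).eval (n : ℤ)).natAbs = gAbs a b c n := by
      rw [eval_quadPoly]; rfl
    have hlt : ((quadPoly a b c).eval (n : ℤ)).natAbs < ⌈(x : ℝ) ^ cc⌉₊ ^ (J' + 1) := by
      have h1 := gAbs_le (b := b) (c := c) ha hY1r hnY
      rw [hval]
      exact_mod_cast lt_of_le_of_lt h1 hbound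
    by_cases hpos : 0 < ((quadPoly a b c).eval (n : ℤ)).natAbs
    · refine le_trans ?_ (card_rough_divisors_le hPzdvd J' _ hpos hlt)
      refine Finset.card_le_card_of_injOn (fun nm : ℕ × ℕ => nm.2) ?_ ?_
      · intro nm hnm
        rw [Finset.mem_coe, Finset.mem_filter, hS, Finset.mem_filter, mem_pairFamily] at hnm
        obtain ⟨⟨⟨-, hrough, hdvd, -⟩, -⟩, hn1⟩ := hnm
        rw [hn1, hg] at hdvd
        rw [hn1] at hrough
        rw [Finset.mem_coe, Finset.mem_filter, Nat.mem_divisors]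
        refine ⟨⟨Int.natCast_dvd.mp hdvd, hpos.ne'⟩, ?_⟩
        rw [hPz, coprime_primesProdBelow_iff]
        intro q hq hqm
        rw [Nat.mem_primesBelow] at hq
        exact (hrough i).2 q (Finset.mem_range.mpr hq.1) hq.2
          (by rw [hg]; exact (Int.natCast_dvd_natCast.mpr hqm).trans hdvd)
      · intro nm₁ h₁ nm₂ h₂ heq
        rw [Finset.mem_coe, Finset.mem_filter] at h₁ h₂
        exact Prod.ext (h₁.2.trans h₂.2.symm) heq
    · -- `g(n) = 0` is excluded by the positivity clause of `pairFamily`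
      have hempty : S.filter (fun nm : ℕ × ℕ => nm.1 = n) = ∅ := by
        refine Finset.filter_false_of_mem fun nm hnm hn1 => hpos ?_
        rw [hS, Finset.mem_filter, mem_pairFamily] at hnm
        have h0 := (hnm.1.2.1 i).1
        rw [hn1, hg] at h0
        exact Int.natAbs_pos.mpr h0.ne'
      rw [hempty, Finset.card_empty]
      exact Nat.zero_le _
  calc ∑ n ∈ Icc 1 Y, #(S.filter fun nm : ℕ × ℕ => nm.1 = n) ≤ ∑ _n ∈ Icc 1 Y, 2 ^ J' :=
        Finset.sum_le_sum hfib
    _ = Y * 2 ^ J' := by rw [Finset.sum_const, Nat.card_Icc, smul_eq_mul]; simp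

end QuadraticSieve

/-- **Anchor of part 4/7**: the registered sub-goal `stub_quadraticSieve_part4` of
`stub_quadraticSieve` (`ledger workitem stub-add`), through which this helper file lands
`--supports stmt-Parity-9469`:
a single member of a Bateman–Horn system is a Bateman–Horn system (Mertens for `ρ_g` via
`exists_hasBatemanHornConst_holds`). [folklore] -/
theorem stub_quadraticSieve_part4 :
    ∀ (k : ℕ) (f : Fin k → ℤ[X]), IsBatemanHornSystem f → ∀ i : Fin k, IsBatemanHornSystem ![f i] :=
  fun _ _ hf i => QuadraticSieve.isBatemanHornSystem_single hf i

end Summit.Parity.BatemanHorn.Cruxes.BalancedSemiprimeLayer.SmoothModulusTwistedHooley
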